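import Mathlib
import HarnessLib
import Summits.HubbardSuperconductivity.HubbardSuperconductivity.Theorems.KLProgrammeH10TwoPointLimitPerturbedCountCalculus

/-!
# Route `KLProgramme` — crux K1 `H10TwoPointLimit` (stmt-HubbardSuperconductivity-19938):
# the perturbed Fermi curve at SECOND order — the twice-differentiated level equation (BGM (2.41), closed form of `u''`)

Third port step of HOME/prover-p4/PORT-NOTE.md ((b3), the input of `odd_transversal` / `even_key` on the perturbed curve). For ANY `C²`
radius function `u` whose polar curve lies on a level set of `E = ε₀ + δ` (`ε₀(u θ·dir θ) + δ(u θ·dir θ) = μ` for all `θ`; `δ ∈ C²`):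

* §1 the polar curve `p(θ) = u(θ)·dir θ = (X_E, Y_E)` has velocity `v = (X_E', Y_E')` and acceleration `(X_E'', Y_E'')` with
  `X_E'' = u'' cos θ - 2u' sin θ - u cos θ`, `Y_E'' = u'' sin θ + 2u' cos θ - u sin θ` (`hasDerivAt_VXE/VYE`, `u'' = deriv (deriv u)`);
* §2 **first-order level identity** `2 sin X_E·X_E' + 2 sin Y_E·Y_E' + Dδ(p)[v] = 0` (`levelIdentity_one`; the tree's `sin_mul_bandVX_add` with the
  `Dδ` term);
* §3 **second-order level identity** `2cos X_E·X_E'² + 2 sin X_E·X_E'' + 2cos Y_E·Y_E'² + 2 sin Y_E·Y_E'' + D²δ(p)[v, v] + Dδ(p)[v'] = 0`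
  (`levelIdentity_two`; the tree's `bandHess_add_grad_dot_acc` with the `δ` terms), and its SOLVED FORM for `u''`:
  `(∂_t F(θ, u) + Dδ(p)[dir θ])·u'' = -(2cos X_E X_E'² + 2cos Y_E Y_E'² + D²δ(p)[v,v]) + 4u'(sin X_E sin θ - sin Y_E cos θ) + u ∂_tF(θ,u)
   - 2u' Dδ(p)[dir(θ + π/2)] + u Dδ(p)[dir θ]` (`radial_second_deriv_identity`) — `u''` in FIRST-order data of the curve plus `D²δ`, with the
  coefficient `∂_tF + Dδ[dir] ≥ Dt_min - κ₁ > 0` of `Dtmin_sub_le_pertDt`; at `δ = 0`, `u = u_ν` it is the free band's `u_ν''`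
  (`radial_second_deriv_identity_band`), so `|u'' - u_ν''| = O(κ₁ + κ₂)` at the shifted level is pure algebra on these two identities
  (next file).

Everything is PROVED; no definitions. References: BGM 2006 §2.4 Lemma 2.1 (2.41) [cite: BenfattoGiulianiMastropietro2006]; tree
`HubbardFermiBandCurvature` (`bandHess_add_grad_dot_acc`).
-/

noncomputable section

namespace Summit.HubbardSuperconductivity.HubbardSuperconductivity.Theorems.PerturbedFermiCurve

set_option linter.dupNamespace false -- summit = problem name (single-conjunct summit), D-0017

open Real Set
open Literature.MathematicalPhysics.QuantumLattice Literature.MathematicalPhysics.QuantumLattice.BandSectorCounting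

/-! ## §1 Velocity and acceleration of the polar curve of a `C²` radius function -/

/-- `(d/dθ) X_E' = u'' cos θ - 2u' sin θ - u cos θ` (`u'' = deriv (deriv u)`). [folklore] -/
theorem hasDerivAt_VXE {u : ℝ → ℝ} {θ : ℝ} (hu : DifferentiableAt ℝ u θ) (hu' : DifferentiableAt ℝ (deriv u) θ) :
    HasDerivAt (VXE u) (deriv (deriv u) θ * Real.cos θ - 2 * deriv u θ * Real.sin θ - u θ * Real.cos θ) θ := by
  have h := (hu'.hasDerivAt.mul (Real.hasDerivAt_cos θ)).sub (hu.hasDerivAt.mul (Real.hasDerivAt_sin θ))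
  refine h.congr_deriv ?_
  ring

/-- `(d/dθ) Y_E' = u'' sin θ + 2u' cos θ - u sin θ`. [folklore] -/
theorem hasDerivAt_VYE {u : ℝ → ℝ} {θ : ℝ} (hu : DifferentiableAt ℝ u θ) (hu' : DifferentiableAt ℝ (deriv u) θ) :
    HasDerivAt (VYE u) (deriv (deriv u) θ * Real.sin θ + 2 * deriv u θ * Real.cos θ - u θ * Real.sin θ) θ := by
  have h := (hu'.hasDerivAt.mul (Real.hasDerivAt_sin θ)).add (hu.hasDerivAt.mul (Real.hasDerivAt_cos θ))
  refine h.congr_deriv ?_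
  ring

/-- The polar curve `θ ↦ u(θ)·dir θ` has velocity `(X_E', Y_E')`. [folklore] -/
theorem hasDerivAt_smul_dir_curve {u : ℝ → ℝ} {θ : ℝ} (hu : DifferentiableAt ℝ u θ) :
    HasDerivAt (fun ϑ => u ϑ • dir ϑ) ![VXE u θ, VYE u θ] θ := by
  have hfun : (fun ϑ => u ϑ • dir ϑ) = fun ϑ => ![XE u ϑ, YE u ϑ] := funext fun ϑ => smul_dir_eq_XE_YE u ϑ
  rw [hfun]
  refine hasDerivAt_pi.2 fun i => ?_
  fin_cases i
  · simpa using hasDerivAt_XE hu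
  · simpa using hasDerivAt_YE hu

/-- The velocity `θ ↦ (X_E', Y_E')` has derivative `(X_E'', Y_E'')`. [folklore] -/
theorem hasDerivAt_velocity {u : ℝ → ℝ} {θ : ℝ} (hu : DifferentiableAt ℝ u θ) (hu' : DifferentiableAt ℝ (deriv u) θ) :
    HasDerivAt (fun ϑ => ![VXE u ϑ, VYE u ϑ])
      ![deriv (deriv u) θ * Real.cos θ - 2 * deriv u θ * Real.sin θ - u θ * Real.cos θ,
        deriv (deriv u) θ * Real.sin θ + 2 * deriv u θ * Real.cos θ - u θ * Real.sin θ] θ := by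
  refine hasDerivAt_pi.2 fun i => ?_
  fin_cases i
  · simpa using hasDerivAt_VXE hu hu'
  · simpa using hasDerivAt_VYE hu hu'

/-- The acceleration vector decomposes as `u''·dir θ + 2u'·dir(θ + π/2) - u·dir θ`. [folklore] -/
theorem acceleration_eq (u : ℝ → ℝ) (θ : ℝ) :
    (![deriv (deriv u) θ * Real.cos θ - 2 * deriv u θ * Real.sin θ - u θ * Real.cos θ,
        deriv (deriv u) θ * Real.sin θ + 2 * deriv u θ * Real.cos θ - u θ * Real.sin θ] : Fin 2 → ℝ) =
      deriv (deriv u) θ • dir θ + (2 * deriv u θ) • dir (θ + π / 2) - u θ • dir θ := by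
  ext i; fin_cases i
  · simp [dir, Real.cos_add_pi_div_two, Real.sin_add_pi_div_two]; ring
  · simp [dir, Real.cos_add_pi_div_two, Real.sin_add_pi_div_two]

/-- The radial transversality coefficient in curve coordinates: `2(sin X_E cos θ + sin Y_E sin θ) = ∂_t F(θ, u θ)`. [folklore] -/
theorem two_mul_sin_dir_eq_rayDispersionDt (u : ℝ → ℝ) (θ : ℝ) :
    2 * (Real.sin (XE u θ) * Real.cos θ + Real.sin (YE u θ) * Real.sin θ) = rayDispersionDt θ (u θ) := by
  simp only [XE, YE, rayDispersionDt]; ring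

/-! ## §2 The first-order level identity along the curve -/

section Level

variable {δ : (Fin 2 → ℝ) → ℝ} (hδ2 : ContDiff ℝ 2 δ) {u : ℝ → ℝ} (hu2 : ContDiff ℝ 2 u) {μ : ℝ}
  (hroot : ∀ θ, sqDispersion (u θ • dir θ) + δ (u θ • dir θ) = μ)
include hδ2 hu2 hroot

omit hδ2 hroot in
/-- A `C²` radius function is differentiable. [folklore] -/
private theorem hu_diff (θ : ℝ) : DifferentiableAt ℝ u θ := (hu2.differentiable (by norm_num)) θ

omit hδ2 hroot in
/-- The derivative of a `C²` radius function is differentiable. [folklore] -/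
private theorem hu'_diff (θ : ℝ) : DifferentiableAt ℝ (deriv u) θ := by
  have h2 : ContDiff ℝ ((1 : WithTop ℕ∞) + 1) u := by rw [one_add_one_eq_two]; exact hu2
  have h : ContDiff ℝ 1 (deriv u) := (contDiff_succ_iff_deriv.1 h2).2.2
  exact (h.differentiable one_ne_zero) θ

omit hu2 hroot in
/-- A `C²` perturbation is differentiable. [folklore] -/
private theorem hδ_diff (k : Fin 2 → ℝ) : DifferentiableAt ℝ δ k := (hδ2.differentiable (by norm_num)) k

omit hu2 hroot in
/-- The gradient of a `C²` perturbation is differentiable. [folklore] -/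
private theorem hδ'_diff (k : Fin 2 → ℝ) : DifferentiableAt ℝ (fderiv ℝ δ) k := by
  have h : ContDiff ℝ 1 (fderiv ℝ δ) := hδ2.fderiv_right (by rw [one_add_one_eq_two])
  exact (h.differentiable one_ne_zero) k

omit hδ2 hroot in
/-- The free part along the curve: `θ ↦ ε₀(p θ)` has derivative `2 sin X_E X_E' + 2 sin Y_E Y_E'`. [folklore] -/
theorem hasDerivAt_sqDispersion_curve (θ : ℝ) :
    HasDerivAt (fun ϑ => sqDispersion (u ϑ • dir ϑ))
      (2 * Real.sin (XE u θ) * VXE u θ + 2 * Real.sin (YE u θ) * VYE u θ) θ := by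
  have hX := hasDerivAt_XE (hu_diff hu2 θ)
  have hY := hasDerivAt_YE (hu_diff hu2 θ)
  have h := (hX.cos.add hY.cos).const_mul (-2)
  have hfun : (fun ϑ => sqDispersion (u ϑ • dir ϑ)) = fun ϑ => -2 * (Real.cos (XE u ϑ) + Real.cos (YE u ϑ)) := by
    funext ϑ; simp [sqDispersion, dir, XE, YE]
  rw [hfun]
  exact h.congr_deriv (by ring)

omit hroot in
/-- The perturbation along the curve: `θ ↦ δ(p θ)` has derivative `Dδ(p)[v]`. [folklore] -/
theorem hasDerivAt_delta_curve (θ : ℝ) :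
    HasDerivAt (fun ϑ => δ (u ϑ • dir ϑ)) (fderiv ℝ δ (u θ • dir θ) ![VXE u θ, VYE u θ]) θ :=
  (hδ_diff hδ2 _).hasFDerivAt.comp_hasDerivAt θ (hasDerivAt_smul_dir_curve (hu_diff hu2 θ))

/-- **First-order level identity** (differentiate `E(p(θ)) = μ`): `2 sin X_E·X_E' + 2 sin Y_E·Y_E' + Dδ(p)[v] = 0`.
[cite: BenfattoGiulianiMastropietro2006, §2.4 Lemma 2.1] -/
theorem levelIdentity_one (θ : ℝ) :
    2 * Real.sin (XE u θ) * VXE u θ + 2 * Real.sin (YE u θ) * VYE u θ + fderiv ℝ δ (u θ • dir θ) ![VXE u θ, VYE u θ] = 0 := by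
  have h := (hasDerivAt_sqDispersion_curve hu2 θ).add (hasDerivAt_delta_curve hδ2 hu2 θ)
  have hconst : HasDerivAt (fun ϑ => sqDispersion (u ϑ • dir ϑ) + δ (u ϑ • dir ϑ)) 0 θ := by
    have : (fun ϑ => sqDispersion (u ϑ • dir ϑ) + δ (u ϑ • dir ϑ)) = fun _ => μ := funext hroot
    rw [this]; exact hasDerivAt_const θ μ
  exact h.unique hconst

/-! ## §3 The second-order level identity and the closed form of `u''` -/

omit hroot in
/-- The `Dδ` term along the curve has derivative `D²δ(p)[v][v] + Dδ(p)[v']`. [folklore] -/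
theorem hasDerivAt_fderiv_delta_curve (θ : ℝ) :
    HasDerivAt (fun ϑ => fderiv ℝ δ (u ϑ • dir ϑ) ![VXE u ϑ, VYE u ϑ])
      (fderiv ℝ (fderiv ℝ δ) (u θ • dir θ) ![VXE u θ, VYE u θ] ![VXE u θ, VYE u θ] +
        fderiv ℝ δ (u θ • dir θ)
          ![deriv (deriv u) θ * Real.cos θ - 2 * deriv u θ * Real.sin θ - u θ * Real.cos θ,
            deriv (deriv u) θ * Real.sin θ + 2 * deriv u θ * Real.cos θ - u θ * Real.sin θ]) θ := by
  have hc : HasDerivAt (fun ϑ => fderiv ℝ δ (u ϑ • dir ϑ)) (fderiv ℝ (fderiv ℝ δ) (u θ • dir θ) ![VXE u θ, VYE u θ]) θ :=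
    (hδ'_diff hδ2 _).hasFDerivAt.comp_hasDerivAt θ (hasDerivAt_smul_dir_curve (hu_diff hu2 θ))
  have hv := hasDerivAt_velocity (hu_diff hu2 θ) (hu'_diff hu2 θ)
  exact hc.clm_apply hv

/-- **Second-order level identity** (differentiate the first one):
`2cos X_E X_E'² + 2 sin X_E X_E'' + 2cos Y_E Y_E'² + 2 sin Y_E Y_E'' + D²δ(p)[v,v] + Dδ(p)[v'] = 0`.
[cite: BenfattoGiulianiMastropietro2006, §2.4 Lemma 2.1 (2.41)] -/
theorem levelIdentity_two (θ : ℝ) :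
    2 * Real.cos (XE u θ) * VXE u θ ^ 2 +
      2 * Real.sin (XE u θ) * (deriv (deriv u) θ * Real.cos θ - 2 * deriv u θ * Real.sin θ - u θ * Real.cos θ) +
      2 * Real.cos (YE u θ) * VYE u θ ^ 2 +
      2 * Real.sin (YE u θ) * (deriv (deriv u) θ * Real.sin θ + 2 * deriv u θ * Real.cos θ - u θ * Real.sin θ) +
      (fderiv ℝ (fderiv ℝ δ) (u θ • dir θ) ![VXE u θ, VYE u θ] ![VXE u θ, VYE u θ] +
        fderiv ℝ δ (u θ • dir θ)
          ![deriv (deriv u) θ * Real.cos θ - 2 * deriv u θ * Real.sin θ - u θ * Real.cos θ,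
            deriv (deriv u) θ * Real.sin θ + 2 * deriv u θ * Real.cos θ - u θ * Real.sin θ]) = 0 := by
  have hX := hasDerivAt_XE (hu_diff hu2 θ)
  have hY := hasDerivAt_YE (hu_diff hu2 θ)
  have hVX := hasDerivAt_VXE (hu_diff hu2 θ) (hu'_diff hu2 θ)
  have hVY := hasDerivAt_VYE (hu_diff hu2 θ) (hu'_diff hu2 θ)
  have hfree : HasDerivAt (fun ϑ => 2 * Real.sin (XE u ϑ) * VXE u ϑ + 2 * Real.sin (YE u ϑ) * VYE u ϑ)
      (2 * Real.cos (XE u θ) * VXE u θ ^ 2 +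
        2 * Real.sin (XE u θ) * (deriv (deriv u) θ * Real.cos θ - 2 * deriv u θ * Real.sin θ - u θ * Real.cos θ) +
        2 * Real.cos (YE u θ) * VYE u θ ^ 2 +
        2 * Real.sin (YE u θ) * (deriv (deriv u) θ * Real.sin θ + 2 * deriv u θ * Real.cos θ - u θ * Real.sin θ)) θ := by
    have h := ((hX.sin.mul hVX).const_mul 2).add ((hY.sin.mul hVY).const_mul 2)
    refine (h.congr_deriv ?_).congr_of_eventuallyEq (Filter.Eventually.of_forall fun ϑ => ?_)
    · ring
    · simp only [Pi.add_apply, Pi.mul_apply]; ring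
  have h := hfree.add (hasDerivAt_fderiv_delta_curve hδ2 hu2 θ)
  have hconst : HasDerivAt (fun ϑ => 2 * Real.sin (XE u ϑ) * VXE u ϑ + 2 * Real.sin (YE u ϑ) * VYE u ϑ +
      fderiv ℝ δ (u ϑ • dir ϑ) ![VXE u ϑ, VYE u ϑ]) 0 θ := by
    have : (fun ϑ => 2 * Real.sin (XE u ϑ) * VXE u ϑ + 2 * Real.sin (YE u ϑ) * VYE u ϑ +
        fderiv ℝ δ (u ϑ • dir ϑ) ![VXE u ϑ, VYE u ϑ]) = fun _ => (0 : ℝ) := funext (levelIdentity_one hδ2 hu2 hroot)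
    rw [this]; exact hasDerivAt_const θ (0 : ℝ)
  have := h.unique hconst
  linarith

/-- **The closed form of `u''` on the perturbed curve** (the second-order identity solved for `u''`):
`(∂_tF(θ,u) + Dδ(p)[dir θ])·u'' = -(2cos X_E X_E'² + 2cos Y_E Y_E'² + D²δ(p)[v,v]) + 4u'(sin X_E sin θ - sin Y_E cos θ) + u·∂_tF(θ,u)
 - 2u'·Dδ(p)[dir(θ + π/2)] + u·Dδ(p)[dir θ]`. [cite: BenfattoGiulianiMastropietro2006, §2.4 Lemma 2.1 (2.41)] -/
theorem radial_second_deriv_identity (θ : ℝ) :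
    (rayDispersionDt θ (u θ) + fderiv ℝ δ (u θ • dir θ) (dir θ)) * deriv (deriv u) θ =
      -(2 * Real.cos (XE u θ) * VXE u θ ^ 2 + 2 * Real.cos (YE u θ) * VYE u θ ^ 2 +
          fderiv ℝ (fderiv ℝ δ) (u θ • dir θ) ![VXE u θ, VYE u θ] ![VXE u θ, VYE u θ]) +
        4 * deriv u θ * (Real.sin (XE u θ) * Real.sin θ - Real.sin (YE u θ) * Real.cos θ) +
        u θ * rayDispersionDt θ (u θ) -
        2 * deriv u θ * fderiv ℝ δ (u θ • dir θ) (dir (θ + π / 2)) + u θ * fderiv ℝ δ (u θ • dir θ) (dir θ) := by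
  have h := levelIdentity_two hδ2 hu2 hroot θ
  rw [acceleration_eq u θ, map_sub, map_add, map_smul, map_smul, map_smul, smul_eq_mul, smul_eq_mul, smul_eq_mul] at h
  rw [← two_mul_sin_dir_eq_rayDispersionDt]
  linarith

end Level

/-- **The free band case** (`δ = 0`, `u = u_ν`): `∂_tF(θ,u_ν)·u_ν'' = -(2cos X X'² + 2cos Y Y'²) + 4u_ν'(sin X sin θ - sin Y cos θ) + u_ν ∂_tF`,
with `u_ν'' = bandRadiusDeriv2 ν θ`, `X' = bandVX`, `Y' = bandVY`. [folklore] -/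
theorem radial_second_deriv_identity_band {ν : ℝ} (hν₁ : -4 < ν) (hν₂ : ν < 0) (θ : ℝ) :
    rayDispersionDt θ (bandFermiRadius ν θ) * bandRadiusDeriv2 ν θ =
      -(2 * Real.cos (bandX ν θ) * bandVX ν θ ^ 2 + 2 * Real.cos (bandY ν θ) * bandVY ν θ ^ 2) +
        4 * bandFermiRadiusDeriv ν θ * (Real.sin (bandX ν θ) * Real.sin θ - Real.sin (bandY ν θ) * Real.cos θ) +
        bandFermiRadius ν θ * rayDispersionDt θ (bandFermiRadius ν θ) := by
  have hroot : ∀ θ, sqDispersion (bandFermiRadius ν θ • dir θ) + (fun _ : Fin 2 → ℝ => (0 : ℝ)) (bandFermiRadius ν θ • dir θ) = ν :=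
    fun θ => by
      show sqDispersion (bandFermiRadius ν θ • dir θ) + 0 = ν
      rw [add_zero]; exact sqDispersion_bandFermiRadius hν₁ hν₂ θ
  have h := radial_second_deriv_identity (δ := fun _ : Fin 2 → ℝ => (0 : ℝ)) (μ := ν) contDiff_const
    (contDiff_bandFermiRadius hν₁ hν₂ (n := 2)) hroot θ
  have hd1 : deriv (bandFermiRadius ν) = bandFermiRadiusDeriv ν := funext (deriv_bandFermiRadius hν₁ hν₂)
  have hd2 : deriv (deriv (bandFermiRadius ν)) θ = bandRadiusDeriv2 ν θ := by rw [hd1]; rfl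
  have hf1 : fderiv ℝ (fun _ : Fin 2 → ℝ => (0 : ℝ)) = 0 := by funext k; simp
  have hf2 : fderiv ℝ (fderiv ℝ (fun _ : Fin 2 → ℝ => (0 : ℝ))) = 0 := by rw [hf1]; funext k; simp
  rw [hf2, hf1, hd2, hd1, VXE_band hν₁ hν₂, VYE_band hν₁ hν₂, XE_band, YE_band] at h
  simp at h
  linarith [h]

end Summit.HubbardSuperconductivity.HubbardSuperconductivity.Theorems.PerturbedFermiCurve

end
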